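import Summits.AtomisticToContinuum.Crystallization.Theorems.ChartedZeroExcessLayeredLatticeLiouvilleYZA

/-!
# NODE 74 (lens-2 g74): (XR♮) ⟸ (SC) ∧ (CM) beneath 73S «ShadowReference» — part YZ — part 2 of 2 (sequel of `…ChartedZeroExcessLayeredLatticeLiouvilleYZA`)

Split for the 400-line cap by the landing lane (hand-2 g35); the module docstring of part 1 (`…ChartedZeroExcessLayeredLatticeLiouvilleYZA`) describes the whole node.  Same namespace; all FQNs unchanged.
0 sorry; standard axioms.
-/

noncomputable section
open scoped BigOperators Classical InnerProductSpace RealInnerProductSpace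
open MeasureTheory Set Metric Filter Topology
open Summit.AtomisticToContinuum.Crystallization.Theorems.ChartedPlanarOrderRigidityDoor (E3 IsClean)
open Summit.AtomisticToContinuum.Crystallization.Theorems.ChartedPlanarOrderDensityDichotomy (μS IsSep)
open Summit.AtomisticToContinuum.Crystallization.Theorems.ChartedPlanarOrderCleanScaleP (IsCleanP IsDoorSetP isCleanP_one_iff isCleanP_mono)
open Summit.AtomisticToContinuum.Crystallization.Theorems.ChartedPlanarOrderMesoCut (LayeredHom EnvClose)
open Summit.AtomisticToContinuum.Crystallization.Theorems.ChartedPlanarOrderDoorLayeredOsc (IsTwoShellAffineGood)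
open Literature.MathematicalPhysics.StatisticalMechanics (lennardJones)

namespace Summit.AtomisticToContinuum.Crystallization.Theorems.ChartedZeroExcessLayeredLatticeLiouville

/-! ### YZ-2  The special-class predicate and the two pieces (SC) / (CM) (typed; binders of (QE) verbatim; every constant symbolic) -/

section Pieces

variable {n : ℕ}

/-- ★ **`IsCoolShadowCrystal σ ϑr Rs ε r rI ℓ S K H L′ w′ U t`** — the output of the SPECIAL (rigid) class: ONE placed crystal for the whole cool shell.
`C = placedCrystal L′ w′ U t` with (i) `U` PROPER (`det U = 1`, so that `U` is an admissible tameness rotation); (ii) `H₀ = LayeredHom L′ w′`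
`σ`-separated; (iii) every `Rs`-environment of `H₀` two-sidedly `ϑr`-shadowed (`EnvClose`, by translation) by an environment of the chart crystal `H`
(radius `Rs ≥ 4 + 2·dB + ε`, so that tube members' `4`-stars are covered); (iv) REG-out: every atom of `S` in the cool zone `r < dist(·, K)`,
`dist(·, k) < ℓ` for some `k`, lies within `ε` of a site of `C`; (v) REG-in: every site of `C` in the zone `rI < dist(·, K)`, `dist(·, k) < ℓ` for some
`k`, lies within `ε` of an atom of `S`.  Nothing of the binders' `(δ, a, aHi, θ)` and no Nash/equilibrium condition is imposed on `H₀` (F18 of part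
YX stands). [this file, g74] -/
def IsCoolShadowCrystal (σ ϑr Rs ε r rI ℓ : ℝ) (S K H : Set E3) (L' : E3 →L[ℝ] E3) (w' : ℤ → E3) (U : E3 ≃ₗᵢ[ℝ] E3) (t : E3) : Prop :=
  LinearMap.det (U.toLinearEquiv : E3 →ₗ[ℝ] E3) = 1 ∧ IsSep σ (LayeredHom L' w') ∧
    (∀ x' ∈ LayeredHom L' w', ∃ x ∈ H, EnvClose ϑr Rs (LayeredHom L' w') x' H x) ∧
      (∀ p ∈ S, (∃ k ∈ K, dist p k < ℓ) → (∀ k ∈ K, r < dist p k) → ∃ c ∈ placedCrystal L' w' U t, dist p c ≤ ε) ∧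
        ∀ c ∈ placedCrystal L' w' U t, (∃ k ∈ K, dist c k < ℓ) → (∀ k ∈ K, rI < dist c k) → ∃ p ∈ S, dist p c ≤ ε

/-- the special class is WEAKER for a smaller separation floor, larger tolerances, a smaller shadow radius and a smaller zone. [this file, g74] -/
theorem IsCoolShadowCrystal.mono {σ σ' ϑr ϑr' Rs Rs' ε ε' r r' rI rI' ℓ ℓ' : ℝ} {S K H : Set E3} {L' : E3 →L[ℝ] E3} {w' : ℤ → E3}
    {U : E3 ≃ₗᵢ[ℝ] E3} {t : E3} (hσ : σ' ≤ σ) (hϑ : ϑr ≤ ϑr') (hR : Rs' ≤ Rs) (hε : ε ≤ ε') (hr : r ≤ r') (hrI : rI ≤ rI') (hℓ : ℓ' ≤ ℓ)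
    (h : IsCoolShadowCrystal σ ϑr Rs ε r rI ℓ S K H L' w' U t) : IsCoolShadowCrystal σ' ϑr' Rs' ε' r' rI' ℓ' S K H L' w' U t := by
  obtain ⟨hdet, hsep, hsh, hout, hin⟩ := h
  refine ⟨hdet, fun x hx y hy hxy => hσ.trans (hsep x hx y hy hxy), fun x' hx' => ?_, fun p hp h1 h2 => ?_, fun c hc h1 h2 => ?_⟩
  · obtain ⟨x, hx, hE⟩ := hsh x' hx'
    exact ⟨x, hx, ChartedPlanarOrderDoorLayered.envClose_mono hϑ (envClose_of_radius_le hR hE)⟩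
  · obtain ⟨k, hk, hpk⟩ := h1
    obtain ⟨c, hc, hpc⟩ := hout p hp ⟨k, hk, lt_of_lt_of_le hpk hℓ⟩ fun k hk => lt_of_le_of_lt hr (h2 k hk)
    exact ⟨c, hc, hpc.trans hε⟩
  · obtain ⟨k, hk, hck⟩ := h1
    obtain ⟨p, hp, hpc⟩ := hin c hc ⟨k, hk, lt_of_lt_of_le hck hℓ⟩ fun k hk => lt_of_le_of_lt hrI (h2 k hk)
    exact ⟨p, hp, hpc.trans hε⟩

/-- ★ **THE SPECIAL CLASS IS INHABITED FROM THE BINDERS (PROVED; the F18 vacuity control)**: the chart crystal `H = LayeredHom L w` ITSELF, unplaced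
(`U = 1`, `t = 0`), is a cool shadow crystal for `S := H` and ANY container `K`, as soon as `H` is `σ`-separated and `ϑr, ε ≥ 0` (every environment shadows
itself, every atom registers itself).  So the `K = ∅` and `S = H` corners of the binders — where g72's placed-perfect-patch class was EMPTY (F18) — are served.
[this file, g74] -/
theorem isCoolShadowCrystal_self {σ ϑr Rs ε r rI ℓ : ℝ} {K : Set E3} {L : E3 →L[ℝ] E3} {w : ℤ → E3}
    (hsep : IsSep σ (LayeredHom L w)) (hϑ : 0 ≤ ϑr) (hε : 0 ≤ ε) :
    IsCoolShadowCrystal σ ϑr Rs ε r rI ℓ (LayeredHom L w) K (LayeredHom L w) L w (LinearIsometryEquiv.refl ℝ E3) 0 := by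
  have hC : placedCrystal L w (LinearIsometryEquiv.refl ℝ E3) 0 = LayeredHom L w := by
    ext c; simp [placedCrystal]
  refine ⟨?_, hsep, fun x' hx' => ⟨x', hx', fun p hp _ => ⟨p, hp, by simpa using hϑ⟩, fun q hq _ => ⟨q, hq, by simpa using hϑ⟩⟩, ?_, ?_⟩
  · show LinearMap.det ((LinearIsometryEquiv.refl ℝ E3).toLinearEquiv : E3 →ₗ[ℝ] E3) = 1
    have : ((LinearIsometryEquiv.refl ℝ E3).toLinearEquiv : E3 →ₗ[ℝ] E3) = LinearMap.id := by ext v; rfl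
    rw [this, LinearMap.det_id]
  · intro p hp _ _
    exact ⟨p, by rw [hC]; exact hp, by rw [dist_self]; exact hε⟩
  · intro c hc _ _
    exact ⟨c, by rw [hC] at hc; exact hc, by rw [dist_self]; exact hε⟩

/-- ★★★ **(SC) «CoolZoneShadowCrystalP ϑc ϑp r q rsh rm σ ϑr Rs ε rI ℓ aHi Λ θ s» — THE COOL SHELL IS ONE PLACED SHADOW CRYSTAL** (the SPECIAL / rigid
class of the dichotomy, owned by the structure theorem = discrete F. John synthesis).  Under the binders of (QE) verbatim up to the moat's coolness (no
core enumeration is needed): there is a placed crystal `C = placedCrystal L′ w′ U t` with `IsCoolShadowCrystal σ ϑr Rs ε r rI ℓ S K H L′ w′ U t` —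
proper placement, `σ`-separated, `Rs`-environments two-sidedly `ϑr`-shadowing the chart crystal `H = LayeredHom L w`, and TWO-SIDED `ε`-REGISTRATION
of `S` and `C` on the cool zone (`S`-atoms from `dist(·, K) > r`, `C`-sites from `dist(·, K) > rI`, both out to `ℓ`).  SPECIAL · KINEMATIC · ATTACKABLE:
(J) the `ϑc`-tame `4`-stars of the moat atoms (`moatIn S K r (r + rsh)`, whose stars reach `dist(·, K) < r + rsh + 4`) overlap along bonded chains and a
thick spherical shell has trivial monodromy, so the per-star rotations/model maps synthesise to ONE proper rigid motion and ONE layered crystal (letters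
and heights per layer read off the collar; continued outside the zone by the `4`-windows of `H`, which costs nothing inside the zone); misfit
`≲ (ϑc/4)·diam(zone) ≈ 8ϑc` at the docket geometry, so `ε ≈ 10ϑc` (free: the column is `∃ ϑm`); REG-in from REG-out + two-shell completeness of clean
atoms (`IsCleanP`: every atom carries a full `18`-point two-shell pattern, so no crystal site of the zone is vacant).  STRICTLY WEAKER than (XR♮) in
content (no filling, no tube) but not a formal consequence (it fixes the registration radii); INSTRUMENTABLE «ShadowFit-T» (census ⑦: fit ONE crystal to
sampled cool collars; report `σ`, `ϑr` at radius `Rs = 5`, `ε` out/in on the zone `(8, 21.5)` / `(10, 21.5)`).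
Why it might fail: RIGID MISFIT — a `ϑc`-cool collar may carry a uniform bend/strain of relative size `ϑc/4`, so one crystal with one linear part misses
it by `≈ (ϑc/4)·31 ≈ 8·10⁻⁵` at `ϑc = 10⁻⁵`: `ε = 10⁻⁴` is at the edge of the John constant (take `ϑc ≤ 10⁻⁶` in the `∃ ϑm` column if the fit says so);
REG-in at the inner rim `rI = r + 2` relies on every atom within `2` of a zone site being cool.
Sources: F. John, CPAM 14 (1961) 391–413 (rotation and strain); Friesecke–James–Müller, CPAM 55 (2002) Thm 3.1; B. Schmidt, Netw. Heterog. Media 4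
(2009) (discrete rigidity); part YX ((XR♮) (J)/(W)); part UC (`IsTameStar`); CRITIC-LEDGER row 1312. [this file, g74] -/
def CoolZoneShadowCrystalP (ϑc ϑp r q rsh rm σ ϑr Rs ε rI ℓ aHi Λ θ s : ℝ) : Prop :=
  ∀ δ : ℝ, 0 < δ → ∀ a : ℝ, 0 < a →
    ∀ S : Set E3, IsDoorSetP aHi δ S → (∀ z : E3, Summable fun y : S => lennardJones (dist z (y : E3))) →
      (∀ p ∈ S, IsTwoShellAffineGood θ S p) →
        ∀ (L : E3 ≃L[ℝ] E3) (w : ℤ → E3), IsEquilChart a s Λ L w →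
          ∀ (x₀ : E3) (K : Set E3), K ⊆ S → (∀ k ∈ K, dist k x₀ ≤ q) →
            IsTameOn ϑp S (LayeredHom (L : E3 →L[ℝ] E3) w) (coreOf S K rm) →
              IsTameOn ϑc S (LayeredHom (L : E3 →L[ℝ] E3) w) (moatIn S K r (r + rsh)) →
                ∃ (L' : E3 →L[ℝ] E3) (w' : ℤ → E3) (U : E3 ≃ₗᵢ[ℝ] E3) (t : E3),
                  IsCoolShadowCrystal σ ϑr Rs ε r rI ℓ S K (LayeredHom (L : E3 →L[ℝ] E3) w) L' w' U t

/-- ★★★ **(CM) «MildCoreFillingP ϑc ϑp r q rsh ρ rm σ ϑr Rs ε rI ℓ ρf d aHi Λ θ s» — THE MILD CORE IS MATCHED TO, AND FILLS, THE SHELL'S CRYSTAL** (the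
GENERIC / loose class of the dichotomy: the sites that are only `ϑp`-tame).  Under the binders of (QE) verbatim, for EVERY placed crystal `C` with
`IsCoolShadowCrystal σ ϑr Rs ε r rI ℓ S K H L′ w′ U t` (the output of (SC), taken as a HYPOTHESIS): there is an INJECTIVE assignment `y₀ : Fin n → C` of
crystal sites to the core atoms with `dist (xf i) (y₀ i) ≤ d` for all `i`, using EVERY crystal site within `ρf` of `K` (occupancy).  On the cool part of
the core (`r < dist(·, K) ≤ ρ`) the assignment is forced by REG-out (`y₀ i :=` the registering site, `d ≥ ε`), so the content is the LOOSE BALL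
`dist(·, K) ≤ r` (+ the rim `≤ rI`): bounded-depth continuation of the registration through `≤ r/0.7 ≈ 12` bonded steps of `ϑp`-tame stars, drift
`≲ (ϑp/4)·r = 0.2` against the budget `d = dm − dB`, and a COUNT (clean + separated atoms in the ball are as many as crystal sites: no vacancy, no
interstitial).  GENERIC · KINEMATIC + COUNTING · UNDECIDED — census test «MildDrift-T»: on sampled admissible cores, the max over core atoms of the distance to
the nearest site of the (SC)-fitted crystal, and the occupancy defect inside `ρf`; PASS iff drift `< d` with margin and defect `0`.  NOT a consequence of
(XR♮) (it pins `y₀` to a GIVEN crystal) and not known to imply 26636.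
Why it might fail: ADVERSARIAL MILD STRAIN — `ϑp = 1/10` admits a loose ball uniformly strained by `2.5 %` relative to `H` (cleanliness allows scales in
`[9/10, 1]`), whose centre then drifts by `≈ 0.025·r = 0.2 = d` from the collar's crystal: the budget is MARGINAL at the record pin `dB = 3/10` (trade:
`dB = 1/10` frees `d = 2/5`); what forbids the adversary is single-site Nash-ness of `S` across the seam (an equilibrium cannot hold a misfitting inclusion
without defects) — an analytic input inside a kinematic piece.
Sources: part YX ((XR♮) clause (M), why-it-might-fail (b) «registry slip»); part YO ((XR)); Conway–Sloane SPLAG ch. 7; E–Ming, ARMA 183 (2007) §2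
(Cauchy–Born vs atomistic near a seam); CRITIC-LEDGER rows 1237 (T1), 1312. [this file, g74] -/
def MildCoreFillingP (ϑc ϑp r q rsh ρ rm σ ϑr Rs ε rI ℓ ρf d aHi Λ θ s : ℝ) : Prop :=
  ∀ δ : ℝ, 0 < δ → ∀ a : ℝ, 0 < a →
    ∀ S : Set E3, IsDoorSetP aHi δ S → (∀ z : E3, Summable fun y : S => lennardJones (dist z (y : E3))) →
      (∀ p ∈ S, IsTwoShellAffineGood θ S p) →
        ∀ (L : E3 ≃L[ℝ] E3) (w : ℤ → E3), IsEquilChart a s Λ L w →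
          ∀ (x₀ : E3) (K : Set E3), K ⊆ S → (∀ k ∈ K, dist k x₀ ≤ q) →
            IsTameOn ϑp S (LayeredHom (L : E3 →L[ℝ] E3) w) (coreOf S K rm) →
              IsTameOn ϑc S (LayeredHom (L : E3 →L[ℝ] E3) w) (moatIn S K r (r + rsh)) →
                ∀ (n : ℕ) (xf : Fin n → E3), Function.Injective xf → Set.range xf = coreOf S K ρ →
                  ∀ (L' : E3 →L[ℝ] E3) (w' : ℤ → E3) (U : E3 ≃ₗᵢ[ℝ] E3) (t : E3),
                    IsCoolShadowCrystal σ ϑr Rs ε r rI ℓ S K (LayeredHom (L : E3 →L[ℝ] E3) w) L' w' U t →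
                      ∃ y₀ : Fin n → E3, Function.Injective y₀ ∧ (∀ i, y₀ i ∈ placedCrystal L' w' U t) ∧ (∀ i, dist (xf i) (y₀ i) ≤ d) ∧
                        ∀ c ∈ placedCrystal L' w' U t, (∃ k ∈ K, dist c k ≤ ρf) → c ∈ Set.range y₀

end Pieces

/-! ### YZ-3  The junction (XR♮) ⟸ (SC) ∧ (CM) (PROVED) and the dial instance -/

section Junction

variable {n : ℕ}

/-- ★★★ **JUNCTION (PROVED): (SC) ∧ (CM) ⇒ (XR♮).**  Given the shell's placed shadow crystal `C` (SC) and the core's matched filling `y₀ ⊆ C` (CM), put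
`X′ := C ∖ range y₀`.  Then (P) `(X′, y₀)` IS a placed `(σ, ϑr)`-shadow patch of `H` (isometry `v ↦ U⁻¹v + t`, shadow radius `Rs ↓ 4`); (R) collar
registration: (M1)/(M2) are REG-out/REG-in plus «a crystal site `ε`-close to an exterior atom is not a reference site, an atom `ε`-close to a
non-reference site is exterior» (hard core `27/32` of `S`, `d + ε < σ ∧ 27/32`, occupancy inside `ρf ≥ rI`), (S1)/(S2) the same with the band
`Rl + ε ≤ Rg ≤ Ru − ε`; (T) the tube clause: reference stars `(4 + 2dB, ϑr + ε)`-tame by `isTameStarR_of_shadow_registered`, members injective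
(`2dB < σ`), off the exterior (exterior atoms stay `≥ σ − ε > dI` from reference sites), matched (`d + dB ≤ dm`) and `ϑ`-tame by part YP's
`isTameStar_tube_of_reference` (`ϑ ≥ ϑ₀ + max sb dI`, `ϑ₀ ≥ ϑr + ε`).  Zone arithmetic: `r ≤ ρ`, `r + rsh ≤ ℓ`, `ρ + d + max(Rg, 4 + 2dB) < ℓ`.
[this file, g74] -/
theorem shadowReferenceP_of_coolShell_mildCore
    {ϑc ϑ ϑp r q rsh ρ rm dm ϑ₀ Rg sb dI dB σ ϑr Rs ε rI ℓ ρf d Rl Ru aHi Λ θ s : ℝ}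
    (haHi : aHi ≤ 1) (hε : 0 ≤ ε) (hdB : 0 ≤ dB) (hRg : 4 + 2 * dB ≤ Rg) (hRs : 4 + 2 * dB + ε ≤ Rs) (hϑ₀ : ϑr + ε ≤ ϑ₀)
    (hϑ : ϑ₀ + max sb dI ≤ ϑ) (hdm : d + dB ≤ dm) (hdε : d + ε < 27 / 32) (hσ₁ : d + ε < σ) (hσ₂ : 2 * dB < σ) (hσ₃ : dI + ε < σ)
    (hdBR : dB ≤ Rg) (hrρ : r ≤ ρ) (hrI : rI ≤ ρf) (hℓ₁ : r + rsh ≤ ℓ) (hℓ₂ : ρ + d + Rg < ℓ) (hℓ₃ : ρ + d + (4 + 2 * dB) < ℓ)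
    (hRl : Rl + ε ≤ Rg) (hRu : Rg + ε ≤ Ru)
    (hSC : CoolZoneShadowCrystalP ϑc ϑp r q rsh rm σ ϑr Rs ε rI ℓ aHi Λ θ s)
    (hCM : MildCoreFillingP ϑc ϑp r q rsh ρ rm σ ϑr Rs ε rI ℓ ρf d aHi Λ θ s) :
    ShadowReferenceP ϑc ϑ ϑp r q rsh ρ rm dm ϑ₀ Rg sb dI dB σ ϑr ε Rl Ru aHi Λ θ s := by
  intro δ hδ a ha S hS hsum hgood L w hLw x₀ K hKS hKq hmild hcool n xf hxf hrange
  obtain ⟨L', w', U, t, hX⟩ := hSC δ hδ a ha S hS hsum hgood L w hLw x₀ K hKS hKq hmild hcool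
  obtain ⟨y₀, hinj, hyC, hd, hfill⟩ :=
    hCM δ hδ a ha S hS hsum hgood L w hLw x₀ K hKS hKq hmild hcool n xf hxf hrange L' w' U t hX
  obtain ⟨hdet, hsep₀, hsh, hregS, hregC⟩ := hX
  have hsepC : IsSep σ (placedCrystal L' w' U t) := isSep_placedCrystal U t hsep₀
  have hS27 : IsSep (27 / 32) S := isSep_of_isDoorSetP haHi hS
  have hxf : ∀ i, xf i ∈ coreOf S K ρ := fun i => hrange ▸ Set.mem_range_self i
  have hxfS : ∀ i, xf i ∈ S := fun i => (hxf i).1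
  have hXout : ∀ p ∈ S \ coreOf S K ρ, p ∈ S ∧ ∀ k ∈ K, ρ < dist p k :=
    fun p hp => ⟨hp.1, fun k hk => not_le.1 fun h => hp.2 ⟨hp.1, k, hk, h⟩⟩
  have huniqC : ∀ c ∈ placedCrystal L' w' U t, ∀ c' ∈ placedCrystal L' w' U t, dist c c' < σ → c = c' := by
    intro c hc c' hc' h
    by_contra hne
    exact absurd (hsepC c hc c' hc' hne) (not_le.2 h)
  have huniqS : ∀ p ∈ S, ∀ p' ∈ S, dist p p' < 27 / 32 → p = p' := by
    intro p hp p' hp' h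
    by_contra hne
    exact absurd (hS27 p hp p' hp' hne) (not_le.2 h)
  -- zone lemma: a point within `T` of a reference site is within `ρ + d + T < ℓ` of some `k ∈ K`
  have hzone : ∀ (i : Fin n) (p : E3) (T : ℝ), dist p (y₀ i) ≤ T → ρ + d + T < ℓ → ∃ k ∈ K, dist p k < ℓ := by
    intro i p T hp hT
    obtain ⟨-, k, hk, hik⟩ := hxf i
    refine ⟨k, hk, ?_⟩
    calc dist p k ≤ dist p (y₀ i) + dist (y₀ i) (xf i) + dist (xf i) k := dist_triangle4 _ _ _ _
      _ ≤ T + d + ρ := by rw [dist_comm (y₀ i) (xf i)]; exact add_le_add (add_le_add hp (hd i)) hik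
      _ < ℓ := by linarith
  -- (U1) a crystal site `ε`-close to an EXTERIOR atom is not a reference site (hard core of `S`)
  have hnotref : ∀ p ∈ S \ coreOf S K ρ, ∀ c ∈ placedCrystal L' w' U t, dist p c ≤ ε → c ∉ Set.range y₀ := by
    rintro p hp c hc hpc ⟨j, rfl⟩
    have hlt : dist p (xf j) < 27 / 32 :=
      calc dist p (xf j) ≤ dist p (y₀ j) + dist (y₀ j) (xf j) := dist_triangle _ _ _
        _ ≤ ε + d := by rw [dist_comm (y₀ j) (xf j)]; exact add_le_add hpc (hd j)
        _ < 27 / 32 := by linarith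
    have hpj : p = xf j := huniqS p (hXout p hp).1 (xf j) (hxfS j) hlt
    exact hp.2 (hpj ▸ hxf j)
  -- (U2) an atom `ε`-close to a NON-reference crystal site is exterior (separation of `C`)
  have hext : ∀ c ∈ placedCrystal L' w' U t, c ∉ Set.range y₀ → ∀ p ∈ S, dist p c ≤ ε → p ∈ S \ coreOf S K ρ := by
    intro c hc hcr p hpS hpc
    refine ⟨hpS, fun hpcore => hcr ?_⟩
    have hpr : p ∈ Set.range xf := by rw [hrange]; exact hpcore
    obtain ⟨j, rfl⟩ := hpr
    have hlt : dist (y₀ j) c < σ :=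
      calc dist (y₀ j) c ≤ dist (y₀ j) (xf j) + dist (xf j) c := dist_triangle _ _ _
        _ ≤ d + ε := by rw [dist_comm (y₀ j) (xf j)]; exact add_le_add (hd j) hpc
        _ < σ := hσ₁
    exact ⟨j, huniqC _ (hyC j) c hc hlt⟩
  -- REG-out at exterior atoms near reference sites
  have hregX : ∀ (i : Fin n), ∀ p ∈ S \ coreOf S K ρ, ∀ T : ℝ, dist p (y₀ i) ≤ T → ρ + d + T < ℓ →
      ∃ c ∈ placedCrystal L' w' U t, dist p c ≤ ε := by
    intro i p hp T hpT hT
    obtain ⟨hpS, hpfar⟩ := hXout p hp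
    exact hregS p hpS (hzone i p T hpT hT) fun k hk => lt_of_le_of_lt hrρ (hpfar k hk)
  -- (U3) exterior atoms within `Rg` of a reference site are `> dI` away from it
  have hfar : ∀ (i : Fin n), ∀ p ∈ S \ coreOf S K ρ, dist p (y₀ i) ≤ Rg → dI < dist p (y₀ i) := by
    intro i p hp hpR
    obtain ⟨c, hc, hpc⟩ := hregX i p hp Rg hpR hℓ₂
    have hci : c ≠ y₀ i := fun h => hnotref p hp c hc hpc ⟨i, h.symm⟩
    have hσle : σ ≤ dist c (y₀ i) := hsepC c hc (y₀ i) (hyC i) hci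
    have htri : dist c (y₀ i) ≤ dist c p + dist p (y₀ i) := dist_triangle _ _ _
    rw [dist_comm c p] at htri
    linarith
  -- non-reference crystal sites are far from `K` (occupancy)
  have hfarC : ∀ c ∈ placedCrystal L' w' U t, c ∉ Set.range y₀ → ∀ k ∈ K, rI < dist c k := by
    intro c hc hcr k hk
    by_contra hle
    push Not at hle
    exact hcr (hfill c hc ⟨k, hk, hle.trans hrI⟩)
  -- (T) reference tameness on the extended stars
  have href : ∀ i, IsTameStarR (4 + 2 * dB) ϑ₀ ((S \ coreOf S K ρ) ∪ Set.range y₀) (LayeredHom (L : E3 →L[ℝ] E3) w) (y₀ i) :=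
    fun i => (isTameStarR_of_shadow_registered (by linarith) (by linarith) hε hdet hsh hyC i
      (fun p hp hpR => hregX i p hp (4 + 2 * dB) hpR hℓ₃)).mono le_rfl hϑ₀
  refine ⟨y₀, placedCrystal L' w' U t \ Set.range y₀, ⟨fun i => (href i).isTameStar (by linarith), fun z hz => ?_⟩, ?_, ?_⟩
  · -- (T) the tube clause
    have hzinj : Function.Injective z :=
      injective_of_mem_bondTube_of_sep (fun i j hij => hsepC _ (hyC i) _ (hyC j) (hinj.ne hij)) hσ₂ hz
    have hzdisj : Disjoint (Set.range z) (S \ coreOf S K ρ) := disjoint_of_mem_bondTube_of_far hfar hdBR hz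
    exact ⟨hzinj, hzdisj, dist_matched_of_mem_bondTube hz hd hdm, isTameStar_tube_of_reference hdB hRg le_rfl hϑ href hz hzinj hzdisj⟩
  · -- (P) the placed shadow patch
    refine ⟨L', w', fun v => U.symm v + t, isometry_unplace U t, hsep₀, fun x' hx' => ?_, hinj, ?_, ?_⟩
    · obtain ⟨x, hx, hE⟩ := hsh x' hx'
      exact ⟨x, hx, envClose_of_radius_le (by linarith) hE⟩
    · rintro _ ⟨i, rfl⟩
      exact ⟨U (y₀ i - t), hyC i, by simp⟩
    · rw [placedCrystal_eq_image]
  · -- (R) collar registration (S1)/(S2)/(M1)/(M2)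
    refine ⟨fun i ⟨p', hp', hip⟩ => ?_, fun i ⟨p, hp, hip⟩ => ?_, fun p hp hpB => ?_, fun p' hp' hpB => ?_⟩
    · -- (S1) class from below
      obtain ⟨hp'C, hp'r⟩ := hp'
      obtain ⟨p, hpS, hpp'⟩ :=
        hregC p' hp'C (hzone i p' Rl (by rw [dist_comm]; exact hip) (by linarith)) (hfarC p' hp'C hp'r)
      refine ⟨p, hext p' hp'C hp'r p hpS hpp', ?_⟩
      calc dist (y₀ i) p ≤ dist (y₀ i) p' + dist p' p := dist_triangle _ _ _
        _ ≤ Rl + ε := by rw [dist_comm p' p]; exact add_le_add hip hpp'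
        _ ≤ Rg := hRl
    · -- (S2) class from above
      obtain ⟨c, hc, hpc⟩ := hregX i p hp Rg (by rw [dist_comm]; exact hip) hℓ₂
      refine ⟨c, ⟨hc, hnotref p hp c hc hpc⟩, ?_⟩
      calc dist (y₀ i) c ≤ dist (y₀ i) p + dist p c := dist_triangle _ _ _
        _ ≤ Rg + ε := add_le_add hip hpc
        _ ≤ Ru := hRu
    · -- (M1) exterior atoms of the zone are matched
      obtain ⟨k, hk, hpk⟩ := hpB
      obtain ⟨hpS, hpfar⟩ := hXout p hp
      obtain ⟨c, hc, hpc⟩ := hregS p hpS ⟨k, hk, by linarith⟩ fun k hk => lt_of_le_of_lt hrρ (hpfar k hk)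
      exact ⟨c, ⟨hc, hnotref p hp c hc hpc⟩, hpc⟩
    · -- (M2) patch sites of the zone are matched
      obtain ⟨hp'C, hp'r⟩ := hp'
      obtain ⟨k, hk, hpk⟩ := hpB
      obtain ⟨p, hpS, hpp'⟩ := hregC p' hp'C ⟨k, hk, by linarith⟩ (hfarC p' hp'C hp'r)
      exact ⟨p, hext p' hp'C hp'r p hpS hpp', hpp'⟩

/-- ★ **(XR♮) at the forecast dials from (SC) ∧ (CM) (PROVED instance)**: docket geometry `(r, q, rsh, ρ, rm, dm) = (8, 4, 12, 16, 16, 1/2)`,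
`(aHi, Λ, θ, s) = (1, 2, 1/16, 1/50)`, record tube `(Rg, sb, dI, dB) = (5, 3/400, 3/400, 3/10)`, tameness `(ϑ₀, ϑ) = (1/5000, 1/100)`, shadow
`(σ, ϑr, Rs) = (3/4, 10⁻⁴, 5)`, registration `ε = 10⁻⁴` on the zones `(8, 43/2)` / `(10, 43/2)`, occupancy radius `ρf = 79999/5000 = ρ − 2ε`, matching
`d = 1/5 = dm − dB`, band `[19/4, 21/4]`; `ϑc`, `ϑp` free (binder levels). [this file, g74] -/
theorem shadowReferenceP_instance_of_coolShell_mildCore {ϑc ϑp : ℝ}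
    (hSC : CoolZoneShadowCrystalP ϑc ϑp 8 4 12 16 (3 / 4) (1 / 10000) 5 (1 / 10000) 10 (43 / 2) 1 2 (1 / 16) (1 / 50))
    (hCM : MildCoreFillingP ϑc ϑp 8 4 12 16 16 (3 / 4) (1 / 10000) 5 (1 / 10000) 10 (43 / 2) (79999 / 5000) (1 / 5) 1 2 (1 / 16) (1 / 50)) :
    ShadowReferenceP ϑc (1 / 100) ϑp 8 4 12 16 16 (1 / 2) (1 / 5000) 5 (3 / 400) (3 / 400) (3 / 10) (3 / 4) (1 / 10000) (1 / 10000)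
      (19 / 4) (21 / 4) 1 2 (1 / 16) (1 / 50) :=
  shadowReferenceP_of_coolShell_mildCore le_rfl (by norm_num) (by norm_num) (by norm_num) (by norm_num) (by norm_num)
    (by rw [max_self]; norm_num) (by norm_num) (by norm_num) (by norm_num) (by norm_num) (by norm_num) (by norm_num) (by norm_num) (by norm_num)
    (by norm_num) (by norm_num) (by norm_num) (by norm_num) (by norm_num) hSC hCM

/-- ★ **(XR♮) ⇒ the OCCUPIED part of (CM)'s conclusion is what (XR♮) itself delivers (PROVED sanity: the cut does not ask for more matching than the
target)**: any shadow reference is injective-free here — we only record that (XR♮)'s tube clause at the trivial member `y₀` gives an injective, exterior-avoiding,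
`dm`-matched `y₀` (so (CM)'s extra content is exactly: values ON the given crystal, radius `d = dm − dB`, occupancy). [this file, g74] -/
theorem matched_of_shadowReferenceP {ϑc ϑ ϑp r q rsh ρ rm dm ϑ₀ Rg sb dI dB σ ϑr ε Rl Ru aHi Λ θ s : ℝ} (hsb : 0 ≤ sb) (hdI : 0 ≤ dI) (hdB : 0 ≤ dB)
    (hR : ShadowReferenceP ϑc ϑ ϑp r q rsh ρ rm dm ϑ₀ Rg sb dI dB σ ϑr ε Rl Ru aHi Λ θ s) :
    ∀ δ : ℝ, 0 < δ → ∀ a : ℝ, 0 < a →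
    ∀ S : Set E3, IsDoorSetP aHi δ S → (∀ z : E3, Summable fun y : S => lennardJones (dist z (y : E3))) →
      (∀ p ∈ S, IsTwoShellAffineGood θ S p) →
        ∀ (L : E3 ≃L[ℝ] E3) (w : ℤ → E3), IsEquilChart a s Λ L w →
          ∀ (x₀ : E3) (K : Set E3), K ⊆ S → (∀ k ∈ K, dist k x₀ ≤ q) →
            IsTameOn ϑp S (LayeredHom (L : E3 →L[ℝ] E3) w) (coreOf S K rm) →
              IsTameOn ϑc S (LayeredHom (L : E3 →L[ℝ] E3) w) (moatIn S K r (r + rsh)) →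
                ∀ (n : ℕ) (xf : Fin n → E3), Function.Injective xf → Set.range xf = coreOf S K ρ →
                  ∃ y₀ : Fin n → E3, Function.Injective y₀ ∧ Disjoint (Set.range y₀) (S \ coreOf S K ρ) ∧ ∀ i, dist (xf i) (y₀ i) ≤ dm := by
  intro δ hδ a ha S hS hsum hgood L w hLw x₀ K hKS hKq hmild hcool n xf hxf hrange
  obtain ⟨y₀, X', hy₀, -, -⟩ := hR δ hδ a ha S hS hsum hgood L w hLw x₀ K hKS hKq hmild hcool n xf hxf hrange
  obtain ⟨hinj, hdisj, hnear, -⟩ := hy₀.2 y₀ (self_mem_bondTube hsb hdI hdB)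
  exact ⟨y₀, hinj, hdisj, hnear⟩

end Junction

end Summit.AtomisticToContinuum.Crystallization.Theorems.ChartedZeroExcessLayeredLatticeLiouville

end
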